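import Literature.Probability.LatticeModels.StrongMixingOfSMT
import HarnessLib

/-!
# Translation covariance of the finite-volume Gibbs distributions of a translation-invariant
# finite-range potential ([MOS94] H2; [Mar99] §2.1–2.2), PROVED

Topic `Literature/Probability/LatticeModels`; cell `ym-ir`, seat lit-3.  Theorems only (no new named fact,
D-0026).  For `U : FRPotential d S r` (finite range, TRANSLATION INVARIANT, [MOS94] hypotheses H1–H2) the
kernels `μ_Λ^τ = U.spec β Λ τ` are translation covariant: `μ_{Λ+k}^τ(f) = μ_Λ^{τ(·+k)}(f(θ_k ·))`
(`FRPotential.integral_spec_image_add`, `θ_k = configShift k`, `(θ_k ω)(x) = ω(x − k)`), hence the mixing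
condition `SMT(Λ, n, α)` is translation invariant (`FRPotential.smt_image_add`), and translates of multiples
of `Q_L` are multiples of `Q_L` (`IsMultipleOf.image_add`).  This is the (tacit) step «without loss of
generality we assume … `x_1 = 0`» of [Mar99] p0162 L33–35 in the proof of Lemma 2.10 / Proposition 2.9, whose
hypothesis only concerns the multiples of `Q_l` inside the FIXED cube `B_{2l}`.  SIBLING-SETTING result
(`ℤ^d` lattice systems); nothing here concerns gauge theories or the Yang–Mills gap.

Sources: [MOS94] F. Martinelli, E. Olivieri, R. Schonmann, CMP 165 (1994) 33–47, §1 H2 (translation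
invariance `U_{X+k}(σ) = U_X(σ(· + k))`); [Mar99] F. Martinelli, LNM 1717 (1999), §2.1 p0153–p0154 (the model),
p0162 L33–35. [cite: Martinelli1999, §2.1]

Contents: `finsetSupDist_image_add`, `cubeQ_image_add`, `isMultipleOf_biUnion_cubeQ` (a
union of lattice cubes `Q_L(Li + c)` with ANY common offset `c` is a multiple of `Q_L`), `IsMultipleOf.image_add`,
`mem_interactionSets`, `interactionSets_image_add`, `FRPotential.hamiltonianIn_image_add`
(`H_{Λ+k}(θ_k ω) = H_Λ(ω)`), `FRPotential.integral_spec_image_add`, `FRPotential.smt_image_add`.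
-/

open MeasureTheory Finset

noncomputable section

namespace Literature.Probability.LatticeModels

variable {d : ℕ}

/-! ### Lattice translations and distances -/

section Geometry

/-- The sup-distance is translation invariant (copy of `supDist_add_right` of `ZdBoxesLines.lean`, which lies
outside this file's import path). [folklore] -/
private theorem supDist_add_right' (x y k : Site d) : supDist (x + k) (y + k) = supDist x y := by
  unfold supDist
  congr 1
  funext i
  congr 1
  simp only [Pi.add_apply]
  ring

/-- The set distance is translation invariant. [cite: Martinelli1999, §2.1] -/
theorem finsetSupDist_image_add (A B : Finset (Site d)) (k : Site d) :
    finsetSupDist (A.image (· + k)) (B.image (· + k)) = finsetSupDist A B := by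
  classical
  rcases A.eq_empty_or_nonempty with rfl | hA
  · simp [finsetSupDist]
  rcases B.eq_empty_or_nonempty with rfl | hB
  · simp [finsetSupDist]
  have hA' : (A.image (· + k)).Nonempty := hA.image _
  have hB' : (B.image (· + k)).Nonempty := hB.image _
  refine le_antisymm ?_ ?_
  · obtain ⟨x, hx, z, hz, heq⟩ := Glauber.exists_finsetSupDist_eq hA hB
    rw [heq, ← supDist_add_right' x z k]
    exact finsetSupDist_le (Finset.mem_image_of_mem _ hx) (Finset.mem_image_of_mem _ hz)
  · obtain ⟨x', hx', z', hz', heq⟩ := Glauber.exists_finsetSupDist_eq hA' hB'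
    obtain ⟨x, hx, rfl⟩ := Finset.mem_image.1 hx'
    obtain ⟨z, hz, rfl⟩ := Finset.mem_image.1 hz'
    rw [heq, supDist_add_right']
    exact finsetSupDist_le hx hz

/-- Translates of lattice cubes: `Q_L(c) + k = Q_L(c + k)`. [cite: Martinelli1999, §2.1] -/
theorem cubeQ_image_add (L : ℕ) (c k : Site d) : (cubeQ L c).image (· + k) = cubeQ L (c + k) := by
  classical
  ext z
  simp only [Finset.mem_image, mem_cubeQ, Pi.add_apply]
  constructor
  · rintro ⟨w, hw, rfl⟩ i
    have := hw i
    simp only [Pi.add_apply]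
    omega
  · intro hz
    refine ⟨z - k, fun i => ?_, sub_add_cancel z k⟩
    have := hz i
    simp only [Pi.sub_apply]
    omega

/-- A finite union of lattice cubes `Q_L(Li + c)` with an ARBITRARY common offset `c ∈ ℤ^d` is a multiple of
`Q_L` (re-centre: `Li + c = L(i + ⌊c/L⌋) + (c mod L)`). [cite: Martinelli1999, §2.1] -/
theorem isMultipleOf_biUnion_cubeQ {L : ℕ} (hL : 0 < L) (I : Finset (Site d)) (c : Site d) :
    IsMultipleOf L (I.biUnion fun i => cubeQ L (L • i + c)) := by
  classical
  have hL' : (0 : ℤ) < L := by exact_mod_cast hL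
  have key : ∀ j, c j % (L : ℤ) + (L : ℤ) * (c j / (L : ℤ)) = c j := fun j => Int.emod_add_mul_ediv _ _
  refine ⟨fun j => c j % (L : ℤ), fun j => ⟨Int.emod_nonneg _ hL'.ne', Int.emod_lt_of_pos _ hL'⟩,
    I.image fun i => i + fun j => c j / (L : ℤ), ?_⟩
  rw [Finset.image_biUnion]
  refine Finset.biUnion_congr rfl fun i _ => ?_
  congr 1
  funext j
  simp only [Pi.add_apply, nsmul_eq_mul, Pi.mul_apply, Pi.natCast_apply]
  linear_combination (-1 : ℤ) * key j

/-- Translates of multiples of `Q_L` are multiples of `Q_L`. [cite: Martinelli1999, §2.1] -/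
theorem IsMultipleOf.image_add {L : ℕ} (hL : 0 < L) {Λ : Finset (Site d)} (h : IsMultipleOf L Λ) (k : Site d) :
    IsMultipleOf L (Λ.image (· + k)) := by
  classical
  obtain ⟨o, -, I, rfl⟩ := h
  rw [Finset.biUnion_image]
  have e : ∀ i : Site d, (cubeQ L (L • i + o)).image (· + k) = cubeQ L (L • i + (o + k)) := fun i => by
    rw [cubeQ_image_add, add_assoc]
  simp_rw [e]
  exact isMultipleOf_biUnion_cubeQ hL I (o + k)

/-- Membership in the family of interaction sets of `Λ` (subsets of the `r`-neighbourhood of `Λ` meeting `Λ`).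
[cite: Martinelli1999, §2.1] -/
theorem mem_interactionSets {r : ℕ} {Λ X : Finset (Site d)} :
    X ∈ interactionSets r Λ ↔ (∀ x ∈ X, ∃ y ∈ Λ, supDist x y ≤ r) ∧ (X ∩ Λ).Nonempty := by
  unfold interactionSets
  simp only [Finset.mem_filter, Finset.mem_powerset, Finset.subset_iff, Finset.mem_biUnion, mem_rNeighbourhood]

/-- The interaction sets of a translate are the translates of the interaction sets. [cite: Martinelli1999, §2.1] -/
theorem interactionSets_image_add (r : ℕ) (Λ : Finset (Site d)) (k : Site d) :
    interactionSets r (Λ.image (· + k)) = (interactionSets r Λ).image fun X => X.image (· + k) := by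
  classical
  ext X
  rw [mem_interactionSets, Finset.mem_image]
  constructor
  · rintro ⟨hsub, hne⟩
    refine ⟨X.image (· - k), mem_interactionSets.2 ⟨?_, ?_⟩, ?_⟩
    · intro x hx
      obtain ⟨x', hx', rfl⟩ := Finset.mem_image.1 hx
      obtain ⟨y', hy', hd⟩ := hsub x' hx'
      obtain ⟨y, hy, rfl⟩ := Finset.mem_image.1 hy'
      refine ⟨y, hy, ?_⟩
      rwa [← supDist_add_right' (x' - k) y k, sub_add_cancel]
    · obtain ⟨z, hz⟩ := hne
      rw [Finset.mem_inter] at hz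
      obtain ⟨y, hy, rfl⟩ := Finset.mem_image.1 hz.2
      exact ⟨y, Finset.mem_inter.2 ⟨Finset.mem_image.2 ⟨y + k, hz.1, add_sub_cancel_right y k⟩, hy⟩⟩
    · rw [Finset.image_image]
      have hid : ((fun x : Site d => x + k) ∘ fun x => x - k) = id := funext fun x => sub_add_cancel x k
      rw [hid, Finset.image_id]
  · rintro ⟨Y, hY, rfl⟩
    obtain ⟨hsub, hne⟩ := mem_interactionSets.1 hY
    refine ⟨fun x hx => ?_, ?_⟩
    · obtain ⟨x', hx', rfl⟩ := Finset.mem_image.1 hx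
      obtain ⟨y, hy, hd⟩ := hsub x' hx'
      exact ⟨y + k, Finset.mem_image.2 ⟨y, hy, rfl⟩, by rwa [supDist_add_right']⟩
    · obtain ⟨z, hz⟩ := hne
      rw [Finset.mem_inter] at hz
      exact ⟨z + k, Finset.mem_inter.2 ⟨Finset.mem_image.2 ⟨z, hz.1, rfl⟩, Finset.mem_image.2 ⟨z, hz.2, rfl⟩⟩⟩

end Geometry

/-! ### Translation covariance of the Hamiltonian and of the kernels -/

section Spec

variable {S : Type*} [MeasurableSpace S] {r : ℕ}

/-- **Translation covariance of the finite-volume Hamiltonian**: `H_{Λ+k}(θ_k ω) = H_Λ(ω)` for a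
translation-invariant finite-range potential ([MOS94] H2). [cite: MartinelliOlivieriSchonmann1994, §1 H1–H2] -/
theorem FRPotential.hamiltonianIn_image_add (U : FRPotential d S r) (Λ : Finset (Site d)) (k : Site d)
    (ω : Site d → S) :
    hamiltonianIn U.U (interactionSets r) (Λ.image (· + k)) (configShift k ω) =
      hamiltonianIn U.U (interactionSets r) Λ ω := by
  classical
  unfold hamiltonianIn
  rw [interactionSets_image_add, Finset.filter_image,
    Finset.sum_image fun X _ Y _ h => Finset.image_injective (add_left_injective k) h]
  refine Finset.sum_congr (Finset.filter_congr fun X _ => ?_) fun X _ => ?_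
  · rw [← Finset.image_inter _ _ (add_left_injective k), Finset.image_nonempty]
  · rw [U.shift k X]
    congr 1
    funext y
    simp [configShift_apply]

variable [Finite S] [MeasurableSingletonClass S]

/-- **Translation covariance of the Gibbs kernels** ([Mar99] §2.2 for the model of §2.1; [MOS94] H2): for every
measurable `f`, `μ_{Λ+k}^τ(f) = μ_Λ^{θ_{−k}τ}(f ∘ θ_k)`, where `(θ_k ω)(x) = ω(x − k)` (`configShift k`) and
`θ_{−k} τ = τ(· + k)`.  Proof: the a priori product measure on `S^{Λ+k}` is the image of that on `S^Λ` under
re-indexing, gluing commutes with the shift, and `H_{Λ+k} ∘ θ_k = H_Λ`. [cite: Martinelli1999, §2.1–2.2] -/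
theorem FRPotential.integral_spec_image_add (U : FRPotential d S r) (β : ℝ) (k : Site d) (Λ : Finset (Site d))
    (τ : Site d → S) {f : (Site d → S) → ℝ} (hf : Measurable f) :
    ∫ ω, f ω ∂(U.spec β (Λ.image (· + k)) τ) = ∫ ω, f (configShift k ω) ∂(U.spec β Λ (configShift (-k) τ)) := by
  classical
  haveI : Fintype S := Fintype.ofFinite S
  set Λ' := Λ.image (· + k) with hΛ'
  set τ' : Site d → S := configShift (-k) τ with hτ'
  set H := hamiltonianIn U.U (interactionSets r) Λ with hH
  set H' := hamiltonianIn U.U (interactionSets r) Λ' with hH'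
  have hmH : Measurable H := measurable_hamiltonianIn (fun A => (U.adapted A).2) _ Λ
  have hmH' : Measurable H' := measurable_hamiltonianIn (fun A => (U.adapted A).2) _ Λ'
  set π : Measure (↥Λ → S) := Measure.pi fun _ => (Measure.count : Measure S) with hπ
  set π' : Measure (↥Λ' → S) := Measure.pi fun _ => (Measure.count : Measure S) with hπ'
  -- re-indexing `Λ ≃ Λ + k`
  have hmem : ∀ x : Site d, x ∈ Λ ↔ x + k ∈ Λ' := fun x => by simp [hΛ']
  set e : ↥Λ ≃ ↥Λ' := (Equiv.addRight k).subtypeEquiv hmem with he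
  set P : (↥Λ → S) ≃ᵐ (↥Λ' → S) := MeasurableEquiv.piCongrLeft (fun _ : ↥Λ' => S) e with hP
  have hPres : MeasurePreserving P π π' := measurePreserving_piCongrLeft (fun _ : ↥Λ' => (Measure.count : Measure S)) e
  have hπ'eq : π' = π.map P := hPres.map_eq.symm
  change ∫ ω, f ω ∂((π'.map (glueWith Λ' · τ)).tilted fun σ => -β * H' σ) =
    ∫ ω, f (configShift k ω) ∂((π.map (glueWith Λ · τ')).tilted fun σ => -β * H σ)
  have hg' : Measurable fun ζ : ↥Λ' → S => glueWith Λ' ζ τ := measurable_glueWith Λ' τ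
  have hg : Measurable fun ζ : ↥Λ → S => glueWith Λ ζ τ' := measurable_glueWith Λ τ'
  have hφ' : Measurable fun σ : Site d → S => -β * H' σ := hmH'.const_mul _
  have hφ : Measurable fun σ : Site d → S => -β * H σ := hmH.const_mul _
  have hcs : Measurable (configShift (S := S) k) := (configShift k).measurable
  rw [integral_tilted_map_eq_integral_tilted_comp π' hg' hφ' hf, hπ'eq,
    integral_tilted_map_eq_integral_tilted_comp π P.measurable (hφ'.comp hg')
      (show Measurable (fun y : ↥Λ' → S => f (glueWith Λ' y τ)) from hf.comp hg'),
    integral_tilted_map_eq_integral_tilted_comp π hg hφ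
      (show Measurable (fun ω : Site d → S => f (configShift k ω)) from hf.comp hcs)]
  -- gluing commutes with the shift
  have key : ∀ ζ : ↥Λ → S, glueWith Λ' (P ζ) τ = configShift k (glueWith Λ ζ τ') := by
    intro ζ
    funext z
    rw [configShift_apply]
    by_cases hz : z ∈ Λ'
    · have hzk : z - k ∈ Λ := by rw [hmem, sub_add_cancel]; exact hz
      rw [glueWith_apply_mem Λ' _ τ hz, glueWith_apply_mem Λ ζ τ' hzk]
      have hez : e ⟨z - k, hzk⟩ = ⟨z, hz⟩ := Subtype.ext (by simp [he])
      rw [← hez, hP, MeasurableEquiv.coe_piCongrLeft, Equiv.piCongrLeft_apply_apply]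
    · have hzk : z - k ∉ Λ := fun h => hz (by rw [hmem, sub_add_cancel] at h; exact h)
      rw [glueWith_apply_not_mem Λ' _ τ hz, glueWith_apply_not_mem Λ ζ τ' hzk, hτ', configShift_apply,
        sub_neg_eq_add, sub_add_cancel]
  have hHs : ∀ ω : Site d → S, H' (configShift k ω) = H ω := fun ω => U.hamiltonianIn_image_add Λ k ω
  have e1 : (((fun σ : Site d → S => -β * H' σ) ∘ fun ζ : ↥Λ' → S => glueWith Λ' ζ τ) ∘ ⇑P) =
      ((fun σ : Site d → S => -β * H σ) ∘ fun ζ : ↥Λ → S => glueWith Λ ζ τ') := by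
    funext ζ
    simp only [Function.comp_apply]
    rw [key, hHs]
  rw [e1]
  refine integral_congr_ae (Filter.Eventually.of_forall fun ζ => ?_)
  simp only []
  rw [key]

/-- **`SMT` is translation invariant**: `SMT(Λ, n, α) ⇒ SMT(Λ + k, n, α)` for the kernels of a translation-invariant
finite-range potential. [cite: Martinelli1999, §2.3–2.4] -/
theorem FRPotential.smt_image_add (U : FRPotential d S r) (β : ℝ) {Λ : Finset (Site d)} {n α : ℝ}
    (h : SMT (U.spec β) Λ n α) (k : Site d) : SMT (U.spec β) (Λ.image (· + k)) n α := by
  classical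
  intro f g Λf Λg Bf Bg hf hg hdf hdg hBf hBg hn τ
  have hcs : Measurable (configShift (S := S) k) := (configShift k).measurable
  rw [U.integral_spec_image_add β k Λ τ (f := fun ω => f ω * g ω) (hf.mul hg),
    U.integral_spec_image_add β k Λ τ hf, U.integral_spec_image_add β k Λ τ hg]
  have hdep : ∀ {u : (Site d → S) → ℝ} {T : Finset (Site d)}, DependsOn u (↑T : Set (Site d)) →
      DependsOn (fun ω => u (configShift k ω)) (↑(T.image (· + -k)) : Set (Site d)) := by
    intro u T hu ω ω' hagree
    apply hu
    intro x hx
    rw [configShift_apply, configShift_apply, sub_eq_add_neg]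
    exact hagree (x + -k) (Finset.mem_coe.2 (Finset.mem_image_of_mem _ (Finset.mem_coe.1 hx)))
  have hdist : finsetSupDist (Λf.image (· + -k)) (Λg.image (· + -k)) = finsetSupDist Λf Λg :=
    finsetSupDist_image_add Λf Λg (-k)
  have hcf : (Λf.image (· + -k)).card = Λf.card := Finset.card_image_of_injective _ (add_left_injective _)
  have hcg : (Λg.image (· + -k)).card = Λg.card := Finset.card_image_of_injective _ (add_left_injective _)
  have key := h (fun ω => f (configShift k ω)) (fun ω => g (configShift k ω)) (Λf.image (· + -k))
    (Λg.image (· + -k)) Bf Bg (hf.comp hcs) (hg.comp hcs) (hdep hdf) (hdep hdg) (fun σ => hBf _)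
    (fun σ => hBg _) (by rw [hdist]; exact hn) (configShift (-k) τ)
  rw [hdist, hcf, hcg] at key
  exact key

/-- **Translation covariance of the Gibbs kernels on events**: `μ_{Λ+k}^τ(E) = μ_Λ^{θ_{−k}τ}(θ_k⁻¹ E)`.
[cite: Martinelli1999, §2.1–2.2] -/
theorem FRPotential.spec_real_image_add (U : FRPotential d S r) (β : ℝ) (k : Site d) (Λ : Finset (Site d))
    (τ : Site d → S) {E : Set (Site d → S)} (hE : MeasurableSet E) :
    (U.spec β (Λ.image (· + k)) τ).real E = (U.spec β Λ (configShift (-k) τ)).real ((configShift k) ⁻¹' E) := by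
  have hE' : MeasurableSet ((configShift (S := S) k) ⁻¹' E) := (configShift k).measurable hE
  rw [← integral_indicator_one hE, ← integral_indicator_one hE',
    U.integral_spec_image_add β k Λ τ (measurable_one.indicator hE)]
  refine integral_congr_ae (Filter.Eventually.of_forall fun ω => ?_)
  rfl

/-- **`SM` is translation invariant**: `SM(Λ, C, m) ⇒ SM(Λ + k, C, m)` for the kernels of a translation-invariant
finite-range potential (so [MOS94] Theorem 1.1 / `MOS1994_weakMixing_imp_strongMixing` gives strong mixing on
every translate of a square `Λ_L` with the same constants). [cite: Martinelli1999, Definition 2.4] -/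
theorem FRPotential.strongMixing_image_add (U : FRPotential d S r) (β : ℝ) {Λ : Finset (Site d)} {C m : ℝ}
    (h : StrongMixing (U.spec β) Λ C m) (k : Site d) : StrongMixing (U.spec β) (Λ.image (· + k)) C m := by
  classical
  intro Δ hΔ y hy τ τ' hττ' A hA hdep
  rw [U.spec_real_image_add β k Λ τ hA, U.spec_real_image_add β k Λ τ' hA]
  -- the translated data
  have hΔ' : Δ.image (· + -k) ⊆ Λ := by
    intro x hx
    obtain ⟨x', hx', rfl⟩ := Finset.mem_image.1 hx
    obtain ⟨w, hw, hwx⟩ := Finset.mem_image.1 (hΔ hx')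
    rw [← hwx, add_neg_cancel_right]
    exact hw
  have hy' : y + -k ∉ Λ := fun h' => hy (Finset.mem_image.2 ⟨y + -k, h', neg_add_cancel_right y k⟩)
  have hττ'' : ∀ z, z ≠ y + -k → configShift (-k) τ z = configShift (-k) τ' z := by
    intro z hz
    rw [configShift_apply, configShift_apply, sub_neg_eq_add]
    exact hττ' (z + k) fun h' => hz (by rw [← h', add_neg_cancel_right])
  have hA' : MeasurableSet ((configShift (S := S) k) ⁻¹' A) := (configShift k).measurable hA
  have hdep' : DependsOn (· ∈ (configShift (S := S) k) ⁻¹' A) (↑(Δ.image (· + -k)) : Set (Site d)) := by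
    intro ω ω' hagree
    simp only [Set.mem_preimage]
    apply hdep
    intro x hx
    rw [configShift_apply, configShift_apply, sub_eq_add_neg]
    exact hagree (x + -k) (Finset.mem_coe.2 (Finset.mem_image_of_mem _ (Finset.mem_coe.1 hx)))
  have key := h (Δ.image (· + -k)) hΔ' (y + -k) hy' _ _ hττ'' _ hA' hdep'
  have hdist : finsetSupDist (Δ.image (· + -k)) {y + -k} = finsetSupDist Δ {y} := by
    have := finsetSupDist_image_add Δ {y} (-k)
    rwa [Finset.image_singleton] at this
  rw [hdist] at key
  exact key

end Spec

end Literature.Probability.LatticeModels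

end
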